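import Literature.Geometry.Riemannian.SphericalCylinderSmallScaleDomination
import Literature.Geometry.Riemannian.SphericalCylinderCheegerYauLargeScale
import Literature.Geometry.Riemannian.SphericalZonalFourDuality
import Literature.Geometry.Riemannian.SphericalZonalKernelSeriesDeriv
import Literature.Analysis.SpecialFunctions.GegenbauerHeatGaussianComparison
import Mathlib.Topology.ContinuousMap.Weierstrass
import HarnessLib

/-!
# Proof of the Cheeger–Yau lower bound for the typed zonal heat series of `S⁴`
# (`CheegerYauZonalSphereFour_holds`)

Sibling of `SphericalCylinderSmallScaleDomination.lean`, which states the named fact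
`CheegerYauZonalSphereFour`: for every `σ > 0` and `c ∈ [-1, 1]`,
`(8π²/3) (4πσ)⁻² e^{-arccos(c)²/4σ} ≤ zonal σ c`, where
`zonal σ c = ∑_k e^{-k(k+3)σ} (2k+3)/3 · C_k^{(3/2)}(c)` (`SphericalCylinderEntropy.lean`) is `vol(S⁴)`
times the heat kernel of the round unit `S⁴` at time `σ` and geodesic distance `arccos c` — the case
`M = S⁴` (`n = 4`, `Ric = 3g ≥ 0`) of the Cheeger–Yau bound `K(t,x,y) ≥ (4πt)^{-n/2} e^{-d(x,y)²/4t}`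
for complete manifolds of non-negative Ricci curvature (Davies, *Heat kernels and spectral theory*,
Thm 5.6.1; Cheeger–Yau 1981).  Here it is PROVED (`CheegerYauZonalSphereFour_holds`), discharging
the fact, and the conditional domination theorem of that file becomes unconditional
(`SphericalCylinderConformal.smallScaleDomination`).

THE PROOF assembles three tree files:
* `SphericalZonalFourDuality.lean` — `∫_{-1}^{1} (1-s²) zonal(t,s) p(s) ds = (4/3) (P_t p)(1)` for
  every finite Gegenbauer sum `p = Σ b_j C_j^{(3/2)}` (`P_t` the polynomial heat flow of `S⁴`,
  `gegenbauerHeat 1`), and every real polynomial is such a `p`;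
* `GegenbauerHeatGaussianComparison.lean` — Cheeger–Yau's comparison in Duhamel form on zonal
  functions: `∫_{-1}^{1} (1-s²) e^{-arccos(s)²/4t}/(8t²) p(s) ds ≤ (P_t p)(1)` for `p ≥ 0` on `[-1,1]`;
* hence (`integral_weightOne_mul_cheegerYauDefect_mul_eval_nonneg`)
  `∫_{-1}^{1} (1-s²) [zonal(t,s) - e^{-arccos(s)²/4t}/(6t²)] q(s) ds ≥ 0` for every polynomial `q ≥ 0`
  on `[-1,1]`, and by Weierstrass approximation of the negative part of the (continuous) bracket,
  `e^{-arccos(s)²/4t}/(6t²) ≤ zonal(t,s)` on `[-1,1]` (`gaussArccos_le_zonal`); finally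
  `1/(6t²) = (8π²/3)(4πt)⁻²`.

## References
* E. B. Davies, *Heat Kernels and Spectral Theory*, CUP 1989, Thm 5.6.1. [Davies1989]
* J. Cheeger, S.-T. Yau, Comm. Pure Appl. Math. 34 (1981) 465–480. [CheegerYau1981]
-/

noncomputable section

open Set MeasureTheory intervalIntegral Filter Polynomial
open scoped Topology Polynomial
open Literature.Geometry.Riemannian.SphericalCylinderEntropy
open Literature.Geometry.Riemannian.SphericalZonalKernelSeries
open Literature.Analysis.SpecialFunctions

namespace Literature.Geometry.Riemannian

namespace SphericalZonalKernelSeries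

/-! ### The pairing of the Cheeger–Yau defect with non-negative polynomials is non-negative -/

/-- The Cheeger–Yau minorant `e^{-arccos(s)²/4t}/(6t²)` is continuous in `s`. [folklore] -/
theorem continuous_gaussArccos (t : ℝ) :
    Continuous fun s : ℝ => Real.exp (-Real.arccos s ^ 2 / (4 * t)) / (6 * t ^ 2) :=
  (Real.continuous_exp.comp ((Real.continuous_arccos.pow 2).neg.div_const _)).div_const _

/-- **Duality + comparison**: for `t > 0` and every real polynomial `q ≥ 0` on `[-1, 1]`,
`∫_{-1}^{1} (1-s²) [zonal(t,s) - e^{-arccos(s)²/4t}/(6t²)] q(s) ds ≥ 0`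
(`q = Σ b_j C_j^{(3/2)}`; `∫ (1-s²) zonal q = (4/3)(P_t q)(1) ≥ (4/3) ∫ (1-s²) e^{-arccos²/4t}/(8t²) q`).
[cite: Davies1989, Thm 5.6.1] -/
theorem integral_weightOne_mul_cheegerYauDefect_mul_eval_nonneg {t : ℝ} (ht : 0 < t) (q : ℝ[X])
    (hq : ∀ s ∈ Icc (-1 : ℝ) 1, 0 ≤ q.eval s) :
    0 ≤ ∫ s in (-1 : ℝ)..1, (1 - s ^ 2) *
      (zonal t s - Real.exp (-Real.arccos s ^ 2 / (4 * t)) / (6 * t ^ 2)) * q.eval s := by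
  obtain ⟨J, b, hb⟩ := exists_gegenbauerHeat_one_eq_eval q
  have h0 : ∀ s ∈ Icc (-1 : ℝ) 1, 0 ≤ gegenbauerHeat 1 b J s 0 := fun s hs => (hb s).symm ▸ hq s hs
  have hpc : Continuous fun s : ℝ => gegenbauerHeat 1 b J s 0 :=
    (continuous_gegenbauerHeat 1 b J).comp (Continuous.prodMk_left (0 : ℝ))
  have hdual := integral_weightOne_mul_zonal_mul_gegenbauerHeat ht b J
  rw [integral_weightOne_eq] at hdual
  have hcomp := integral_weightOne_mul_gaussArccos_mul_le_gegenbauerHeat b J h0 ht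
  have hzc := SphericalZonalKernelSeries.continuous_zonal ht
  have hgc := continuous_gaussArccos t
  have hI1 : IntervalIntegrable (fun s => (1 - s ^ 2) * zonal t s * gegenbauerHeat 1 b J s 0)
      volume (-1) 1 :=
    (((by fun_prop : Continuous fun s : ℝ => 1 - s ^ 2).mul hzc).mul hpc).intervalIntegrable _ _
  have hI2 : IntervalIntegrable (fun s => (1 - s ^ 2) *
      (Real.exp (-Real.arccos s ^ 2 / (4 * t)) / (8 * t ^ 2)) * gegenbauerHeat 1 b J s 0)
      volume (-1) 1 :=
    (((by fun_prop : Continuous fun s : ℝ => 1 - s ^ 2).mul ((Real.continuous_exp.comp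
      ((Real.continuous_arccos.pow 2).neg.div_const _)).div_const _)).mul hpc).intervalIntegrable _ _
  have hsplit : ∫ s in (-1 : ℝ)..1, (1 - s ^ 2) *
      (zonal t s - Real.exp (-Real.arccos s ^ 2 / (4 * t)) / (6 * t ^ 2)) * q.eval s =
      (∫ s in (-1 : ℝ)..1, (1 - s ^ 2) * zonal t s * gegenbauerHeat 1 b J s 0) -
        (4 / 3) * ∫ s in (-1 : ℝ)..1, (1 - s ^ 2) *
          (Real.exp (-Real.arccos s ^ 2 / (4 * t)) / (8 * t ^ 2)) * gegenbauerHeat 1 b J s 0 := by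
    rw [← intervalIntegral.integral_const_mul, ← intervalIntegral.integral_sub hI1 (hI2.const_mul _)]
    refine intervalIntegral.integral_congr fun s _ => ?_
    simp only [← hb s]
    field_simp
    ring
  rw [hsplit, hdual]
  linarith

/-! ### Polynomial approximation: the pointwise bound -/

/-- **`e^{-arccos(s)²/4t}/(6t²) ≤ zonal(t, s)` for `t > 0`, `s ∈ [-1, 1]`** — the Cheeger–Yau bound
for the typed `S⁴` kernel with the constant written as `1/(6t²) = (8π²/3)(4πt)⁻²`.  From the
integrated inequality against all polynomials `q ≥ 0` (previous theorem) by Weierstrass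
approximation of the negative part `g = max(-F, 0)` of the continuous defect `F`:
`∫ (1-s²) F q_ε ≥ 0` with `g ≤ q_ε ≤ g + 2ε` forces `∫ (1-s²) g² ≤ 2ε ∫ (1-s²)|F|` for all `ε`,
so `g = 0`. [cite: Davies1989, Thm 5.6.1] -/
theorem gaussArccos_le_zonal {t : ℝ} (ht : 0 < t) {s : ℝ} (hs : s ∈ Icc (-1 : ℝ) 1) :
    Real.exp (-Real.arccos s ^ 2 / (4 * t)) / (6 * t ^ 2) ≤ zonal t s := by
  set F : ℝ → ℝ := fun s => zonal t s - Real.exp (-Real.arccos s ^ 2 / (4 * t)) / (6 * t ^ 2)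
    with hF
  have hFc : Continuous F := (SphericalZonalKernelSeries.continuous_zonal ht).sub (continuous_gaussArccos t)
  set g : ℝ → ℝ := fun s => max (-F s) 0 with hg
  have hgc : Continuous g := hFc.neg.max continuous_const
  have hg0 : ∀ s, 0 ≤ g s := fun s => le_max_right _ _
  have hFg : ∀ s, F s * g s = -(g s) ^ 2 := by
    intro s
    by_cases h : 0 ≤ F s
    · have : g s = 0 := by rw [hg]; exact max_eq_right (neg_nonpos.2 h)
      rw [this]; ring
    · have : g s = -F s := by rw [hg]; exact max_eq_left (by linarith [lt_of_not_ge h])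
      rw [this]; ring
  have hw : Continuous fun s : ℝ => 1 - s ^ 2 := by fun_prop
  have hw0 : ∀ s ∈ Icc (-1 : ℝ) 1, 0 ≤ 1 - s ^ 2 := fun s hs => by nlinarith [hs.1, hs.2]
  -- the integrated consequence: `∫ (1-s²) g² ≤ 2 ε C` for every `ε > 0`
  set C := ∫ s in (-1 : ℝ)..1, (1 - s ^ 2) * |F s| with hC
  have hC0 : 0 ≤ C := intervalIntegral.integral_nonneg (by norm_num) fun s hs =>
    mul_nonneg (hw0 s hs) (abs_nonneg _)
  have hIg2 : IntervalIntegrable (fun s => (1 - s ^ 2) * g s ^ 2) volume (-1) 1 :=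
    (hw.mul (hgc.pow 2)).intervalIntegrable _ _
  have hstep : ∀ ε : ℝ, 0 < ε → ∫ s in (-1 : ℝ)..1, (1 - s ^ 2) * g s ^ 2 ≤ 2 * ε * C := by
    intro ε hε
    obtain ⟨p, hp⟩ := exists_polynomial_near_of_continuousOn (-1) 1 g hgc.continuousOn ε hε
    set q : ℝ[X] := p + Polynomial.C ε with hqdef
    have hq : ∀ s ∈ Icc (-1 : ℝ) 1, g s ≤ q.eval s ∧ q.eval s ≤ g s + 2 * ε := by
      intro s hs
      have h := abs_lt.1 (hp s hs)
      simp only [hqdef, eval_add, eval_C]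
      constructor <;> linarith
    have hqnn : ∀ s ∈ Icc (-1 : ℝ) 1, 0 ≤ q.eval s := fun s hs => (hg0 s).trans (hq s hs).1
    have hI := integral_weightOne_mul_cheegerYauDefect_mul_eval_nonneg ht q hqnn
    have hqc : Continuous fun s => q.eval s := q.continuous
    have hIa : IntervalIntegrable (fun s => -((1 - s ^ 2) * g s ^ 2)) volume (-1) 1 := hIg2.neg
    have hIb : IntervalIntegrable (fun s => 2 * ε * ((1 - s ^ 2) * |F s|)) volume (-1) 1 :=
      ((hw.mul hFc.abs).intervalIntegrable (-1) 1).const_mul (2 * ε)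
    have hle : ∫ s in (-1 : ℝ)..1, (1 - s ^ 2) * F s * q.eval s ≤
        ∫ s in (-1 : ℝ)..1, (-((1 - s ^ 2) * g s ^ 2) + 2 * ε * ((1 - s ^ 2) * |F s|)) := by
      refine intervalIntegral.integral_mono_on (by norm_num)
        (((hw.mul hFc).mul hqc).intervalIntegrable _ _) (hIa.add hIb) fun s hs => ?_
      have h1 := hq s hs
      have h2 : F s * (q.eval s - g s) ≤ |F s| * (2 * ε) := by
        calc F s * (q.eval s - g s) ≤ |F s| * (q.eval s - g s) :=
              mul_le_mul_of_nonneg_right (le_abs_self _) (by linarith [h1.1])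
          _ ≤ |F s| * (2 * ε) := mul_le_mul_of_nonneg_left (by linarith [h1.2]) (abs_nonneg _)
      have h3 : (1 - s ^ 2) * F s * q.eval s =
          (1 - s ^ 2) * (F s * g s) + (1 - s ^ 2) * (F s * (q.eval s - g s)) := by ring
      rw [h3, hFg]
      nlinarith [hw0 s hs]
    rw [intervalIntegral.integral_add hIa hIb, intervalIntegral.integral_neg,
      intervalIntegral.integral_const_mul] at hle
    have hF' : ∫ s in (-1 : ℝ)..1, (1 - s ^ 2) * F s * q.eval s =
        ∫ s in (-1 : ℝ)..1, (1 - s ^ 2) *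
          (zonal t s - Real.exp (-Real.arccos s ^ 2 / (4 * t)) / (6 * t ^ 2)) * q.eval s := rfl
    rw [hF'] at hle
    linarith
  have hkey : ∫ s in (-1 : ℝ)..1, (1 - s ^ 2) * g s ^ 2 ≤ 0 := by
    refine le_of_forall_pos_lt_add fun ε hε => ?_
    have h := hstep (ε / (2 * C + 1)) (by positivity)
    have h2 : 2 * (ε / (2 * C + 1)) * C < ε := by
      rw [mul_comm 2, mul_assoc, div_mul_eq_mul_div, div_lt_iff₀ (by positivity)]
      nlinarith
    linarith
  -- hence `g = 0` on `(-1, 1)`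
  have hopen : ∀ y ∈ Ioo (-1 : ℝ) 1, g y = 0 := by
    intro y hy
    by_contra hne
    have hpos : 0 < g y := lt_of_le_of_ne (hg0 y) (Ne.symm hne)
    have hev : ∀ᶠ x in 𝓝 y, 0 < g x := hgc.continuousAt.eventually (lt_mem_nhds hpos)
    obtain ⟨ε, hε, hball⟩ := Metric.eventually_nhds_iff.1 hev
    set δ := min ε (min ((y + 1) / 2) ((1 - y) / 2)) with hδ
    have hδ0 : 0 < δ := lt_min hε (lt_min (by linarith [hy.1]) (by linarith [hy.2]))
    have hδε : δ ≤ ε := min_le_left _ _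
    have hδy : δ ≤ (y + 1) / 2 := (min_le_right _ _).trans (min_le_left _ _)
    have hδy' : δ ≤ (1 - y) / 2 := (min_le_right _ _).trans (min_le_right _ _)
    set f : ℝ → ℝ := fun x => (1 - x ^ 2) * g x ^ 2 with hf
    have hfc : Continuous f := hw.mul (hgc.pow 2)
    have hfnn : ∀ x ∈ Icc (-1 : ℝ) 1, 0 ≤ f x := fun x hx => mul_nonneg (hw0 x hx) (sq_nonneg _)
    have hposI : 0 < ∫ x in (y - δ)..(y + δ), f x := by
      refine intervalIntegral.intervalIntegral_pos_of_pos_on (hfc.intervalIntegrable _ _)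
        (fun x hx => ?_) (by linarith)
      have hx01 : 0 < 1 - x ^ 2 := by nlinarith [hx.1, hx.2]
      have hgx : 0 < g x := hball (by rw [Real.dist_eq, abs_lt]; constructor <;> linarith [hx.1, hx.2])
      exact mul_pos hx01 (pow_pos hgx 2)
    have hle : ∫ x in (y - δ)..(y + δ), f x ≤ ∫ x in (-1 : ℝ)..1, f x :=
      intervalIntegral.integral_mono_interval (by linarith) (by linarith) (by linarith)
        ((ae_restrict_mem measurableSet_Ioc).mono fun x hx => hfnn x ⟨hx.1.le, hx.2⟩)
        (hfc.intervalIntegrable _ _)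
    have : (0 : ℝ) < ∫ x in (-1 : ℝ)..1, f x := hposI.trans_le hle
    linarith
  -- `F ≥ 0` on `(-1, 1)`, then on `[-1, 1]` by continuity
  have hopen' : ∀ y ∈ Ioo (-1 : ℝ) 1, 0 ≤ F y := by
    intro y hy
    have h := hopen y hy
    rw [hg] at h
    have := le_max_left (-F y) 0
    simp only at h
    linarith [h ▸ this]
  have hclosed : IsClosed {y : ℝ | 0 ≤ F y} := isClosed_le continuous_const hFc
  have hsub := hclosed.closure_subset_iff.2 (show Ioo (-1 : ℝ) 1 ⊆ _ from hopen')
  rw [closure_Ioo (by norm_num : (-1 : ℝ) ≠ 1)] at hsub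
  have h := hsub hs
  simp only [mem_setOf_eq, hF] at h
  linarith

end SphericalZonalKernelSeries

/-! ### The named fact, discharged -/

/-- **Cheeger–Yau lower bound for the heat kernel of the round `S⁴` on the typed zonal series,
PROVED**: for every `σ > 0` and `c ∈ [-1, 1]`,
`(8π²/3) (4πσ)⁻² exp(-arccos(c)²/4σ) ≤ 𝔥(σ, c) = ∑_k e^{-k(k+3)σ} (2k+3)/3 · C_k^{(3/2)}(c)`
(Davies Thm 5.6.1 for `M = S⁴`; the `k = 0` normalisation `vol S⁴ = 8π²/3`).  Discharges the named
fact `CheegerYauZonalSphereFour`. [cite: Davies1989, Thm 5.6.1] -/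
theorem CheegerYauZonalSphereFour_holds : CheegerYauZonalSphereFour := by
  intro σ hσ c hc₁ hc₂
  have hπ : 0 < Real.pi := Real.pi_pos
  have hpre : (8 * Real.pi ^ 2 / 3) * ((4 * Real.pi * σ) ^ 2)⁻¹ = 1 / (6 * σ ^ 2) := by
    field_simp
    ring
  have h := SphericalZonalKernelSeries.gaussArccos_le_zonal hσ (s := c) ⟨hc₁, hc₂⟩
  rw [hpre]
  calc 1 / (6 * σ ^ 2) * Real.exp (-Real.arccos c ^ 2 / (4 * σ))
      = Real.exp (-Real.arccos c ^ 2 / (4 * σ)) / (6 * σ ^ 2) := by ring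
    _ ≤ zonal σ c := h

namespace SphericalCylinderConformal

/-- **Small-scale conformal domination, unconditionally**: the statement of
`smallScaleDomination_of_cheegerYau` (stub `stub_smallScaleDomination` of line
`conformal-kernel-domination`, crux `CylinderEntropy.SliceIsolation` of route
`SmoothPoincare4/CylinderEntropy`) with the Cheeger–Yau hypothesis discharged by
`CheegerYauZonalSphereFour_holds`. [folklore] -/
theorem smallScaleDomination :
    ∀ δ : ℝ, 0 < δ → ∃ t₁ : ℝ, 0 < t₁ ∧
      ∀ (t₀ : ℝ) (A : Set (EuclideanSpace ℝ (Fin 6))),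
        A ⊆ {z : EuclideanSpace ℝ (Fin 6) | ∑ i : Fin 5, z (Fin.castSucc i) ^ 2 = 1} → MeasurableSet A →
        (∀ z ∈ A, |z 5 - t₀| ≤ 1) →
        ∀ (y : EuclideanSpace ℝ (Fin 5)) (t : ℝ), 0 < t → t ≤ t₁ * Real.exp (2 * t₀) →
          gaussianArea 4 y t
            ((fun z : EuclideanSpace ℝ (Fin 6) =>
          (WithLp.toLp 2 (fun i : Fin 5 => Real.exp (z 5) * z (Fin.castSucc i)) :
            EuclideanSpace ℝ (Fin 5))) '' A) ≤
            ENNReal.ofReal (1 + δ) * cylEntropy A :=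
  smallScaleDomination_of_cheegerYau CheegerYauZonalSphereFour_holds

end SphericalCylinderConformal

end Literature.Geometry.Riemannian

end
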